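/-
Copyright (c) 2026 the pub-hodgecm-mathlib formalisation cell (harness21).  Prover seat hodgecm-mathlib-F0P2-p02 (g26); E1 keeper ∕ dealer F0P3a-p03 (g29), E1 BRICK LEDGER
row 47a «EULER CHARACTERISTIC OF RANKS OVER A DOMAIN» (census `F0/P3/F0P3-p02/g26/nonell/CENSUS-NONELL-VANISHING.v1` 8048f152, §2 (A3a) ∕ §5 R47-a).
-/
import Mathlib.LinearAlgebra.Dimension.Localization
import Mathlib.LinearAlgebra.Dimension.Finite
import Mathlib.LinearAlgebra.Dimension.Constructions
import Mathlib.LinearAlgebra.FiniteDimensional.Lemmas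
import Mathlib.RingTheory.Finiteness.Cardinality
import Mathlib.RingTheory.Noetherian.Basic
import Mathlib.LinearAlgebra.FreeModule.StrongRankCondition
import Mathlib.RingTheory.TensorProduct.Finite
import Mathlib.Algebra.Polynomial.Laurent
import Mathlib.Algebra.MonoidAlgebra.Module
import HarnessLib

/-!
# The Euler characteristic of ranks along a short exact sequence over a commutative domain, and «finite-dimensional ⇒ rank zero» over an infinite-dimensional algebra
# (the rank bookkeeping of «`EP_T ≡ 0`»: a free resolution `0 → C₁ → C₀ → V → 0` over `k[τ^±]` with `V` finite-dimensional has `rank C₀ = rank C₁`)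

Generic commutative algebra, Mathlib-only, THEOREMS ONLY (no `def`, no instance, no notation, no named fact, no `sorry`).  DEDUP RECORD (what is Mathlib and is CITED, not restated):
rank–nullity over a commutative domain is Mathlib `IsDomain.hasRankNullity` (`LinearMap.rank_range_add_rank_ker`, `LinearMap.rank_eq_of_surjective`, `rank_quotient_add_rank_of_isDomain`);
«the rank is the dimension over the fraction field ∕ after localisation» is Mathlib `IsLocalizedModule.rank_eq`, `IsLocalization.rank_eq`, `IsBaseChange.finrank_eq` — so a consumer may
work with `Module.rank R` throughout and never tensor with `Frac R`; «rank zero ⟺ torsion» is Mathlib `rank_eq_zero_iff` ∕ `rank_eq_zero_iff_isTorsion`; the rank of a base change is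
Mathlib `Module.rank_baseChange` ∕ `Module.finrank_baseChange`; the Euler characteristic of a finite exact sequence over a DIVISION RING is Mathlib
`Module.sum_neg_one_pow_finrank_eq_zero_of_exact`.  What this file adds is the thin glue a consumer wants BY NAME:

* §1 (`R` with rank–nullity, e.g. any commutative domain): for `A —ι→ M —p→ B` with `ι` injective, `p` surjective and `Function.Exact ι p`,
  **`rank_eq_rank_add_rank_of_exact`**: `rank_R M = rank_R A + rank_R B`; the three-term EULER CHARACTERISTIC `rank A − rank M + rank B = 0` is this identity.  With
  `rank_R B = 0` (torsion quotient): `rank_eq_rank_of_exact_of_rank_eq_zero` (`rank_R M = rank_R A`).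
* §2 (`R` an algebra over a field `k`, NOT finite-dimensional over `k`; `M` an `R`-module finite-dimensional over `k`): every `m ∈ M` is killed by a non-zero element of `R`
  (`exists_ne_zero_smul_eq_zero_of_finiteDimensional`: `r ↦ r • m` cannot be injective), hence **`rank_eq_zero_of_finiteDimensional`**: `rank_R M = 0`.  The model case
  `R = k[τ^±]` (`LaurentPolynomial k`): `not_module_finite_laurentPolynomial` (the monomials `T^n`, `n ∈ ℤ`, are a `k`-basis), `rank_laurentPolynomial_eq_zero_of_finiteDimensional`.
* §3 THE CONSUMER'S FORM (`rank_eq_rank_of_exact_of_finiteDimensional`, `finrank_eq_finrank_of_free_resolution`): for `0 → C₁ → C₀ → V → 0` exact over such an `R` (a domain) with `V`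
  finite-dimensional over `k`, `rank_R C₀ = rank_R C₁`; if moreover `C_q ≃ R ⊗_k W_q` with `W_q` finite-dimensional, `dim_k W₀ = dim_k W₁`.
Consumer (cell `pub/hodgecm-mathlib`, crux H413, E1 row 47 route A (A3)): the Jacquet functor applied to the Schneider–Stuhler resolution of a finite-length `V` restricted to a Borel
gives `0 → (C₁)_N → (C₀)_N → V_N → 0` with `(C_q)_N ≅ ℂ[T∕T_c] ⊗_ℂ W_q` free over `ℂ[τ^±]` and `V_N` finite-dimensional, whence `dim W₀ = dim W₁` isotype by isotype — «`EP_T ≡ 0`»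
without `Ext`.  HONEST LABEL: count-neutral generic helper; HC_CM is proved only modulo the printed citations until rung 0 closes.

SOURCES (what is formalised, read at our letters).  [Bourbaki1989CommAlg, Ch. II §2 no. 4 Thm. 1] (the ring of fractions `S⁻¹A` is a flat `A`-module — so `K ⊗_A ·`, `K` the field
of fractions of a domain, is exact and the rank `dim_K (K ⊗_A M)` is additive on short exact sequences); [Lang2002, Ch. XVI §3 (flat modules) and §4 (extension of the base), Ch. III §5
(dimension of vector spaces)]; the Laurent-polynomial model `k[τ^±] = k[ℤ]` with its monomial basis is [Lang2002, Ch. II §3 (polynomials and group rings)].  Nothing here is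
specific to the consumer.
-/

set_option autoImplicit false

namespace Literature.LinearAlgebra.RankEulerCharacteristic

open Function

/-! ## §1 The Euler characteristic of ranks along a short exact sequence -/

section Exact

universe u v

variable {R : Type u} [Ring R] [HasRankNullity.{v} R]
  {A M B : Type v} [AddCommGroup A] [Module R A] [AddCommGroup M] [Module R M] [AddCommGroup B] [Module R B]

/-- **RANK IS ADDITIVE ON SHORT EXACT SEQUENCES** over a ring with rank–nullity (every commutative domain: Mathlib `IsDomain.hasRankNullity`): for `A —ι→ M —p→ B` with `ι` injective,
`p` surjective and `range ι = ker p`, `rank_R M = rank_R A + rank_R B` — Mathlib `LinearMap.rank_eq_of_surjective` plus `ker p = range ι ≃ A`.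
[cite: Bourbaki1989CommAlg, Ch. II §2 no. 4 Thm. 1] [cite: Lang2002, Ch. XVI §3] -/
theorem rank_eq_rank_add_rank_of_exact (ι : A →ₗ[R] M) (p : M →ₗ[R] B) (hι : Injective ι) (hexact : Exact ι p) (hp : Surjective p) :
    Module.rank R M = Module.rank R A + Module.rank R B := by
  rw [LinearMap.rank_eq_of_surjective hp, hexact.linearMap_ker_eq, ← (LinearEquiv.ofInjective ι hι).rank_eq, add_comm]

/-- **THE THREE-TERM EULER CHARACTERISTIC WITH A RANK-ZERO END**: if `rank_R B = 0` (e.g. `B` torsion over a domain, Mathlib `rank_eq_zero_iff_isTorsion`) then `rank_R M = rank_R A`.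
[cite: Bourbaki1989CommAlg, Ch. II §2 no. 4 Thm. 1] [cite: Lang2002, Ch. XVI §3] -/
theorem rank_eq_rank_of_exact_of_rank_eq_zero (ι : A →ₗ[R] M) (p : M →ₗ[R] B) (hι : Injective ι) (hexact : Exact ι p) (hp : Surjective p)
    (hB : Module.rank R B = 0) : Module.rank R M = Module.rank R A := by
  rw [rank_eq_rank_add_rank_of_exact ι p hι hexact hp, hB, add_zero]

/-- The `finrank` form (all three ranks finite as soon as `rank_R M` is, since `rank A, rank B ≤ rank M`): for `M` of finite rank, `finrank_R M = finrank_R A + finrank_R B`.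
[cite: Bourbaki1989CommAlg, Ch. II §2 no. 4 Thm. 1] [cite: Lang2002, Ch. XVI §3] -/
theorem finrank_eq_finrank_add_finrank_of_exact (ι : A →ₗ[R] M) (p : M →ₗ[R] B) (hι : Injective ι) (hexact : Exact ι p) (hp : Surjective p)
    (hM : Module.rank R M < Cardinal.aleph0) : Module.finrank R M = Module.finrank R A + Module.finrank R B := by
  have h := rank_eq_rank_add_rank_of_exact ι p hι hexact hp
  have hA : Module.rank R A < Cardinal.aleph0 := lt_of_le_of_lt (by rw [h]; exact le_self_add) hM
  have hB : Module.rank R B < Cardinal.aleph0 := lt_of_le_of_lt (by rw [h]; exact le_add_self) hM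
  have := congrArg Cardinal.toNat h
  rwa [Cardinal.toNat_add hA hB] at this

end Exact

/-! ## §2 Finite-dimensional modules over an infinite-dimensional algebra have rank zero -/

section RankZero

variable {k : Type*} [Field k] {R : Type*} [Ring R] [Algebra k R]
  {M : Type*} [AddCommGroup M] [Module R M] [Module k M] [IsScalarTower k R M]

/-- **EVERY ELEMENT IS TORSION**: if `R` is a `k`-algebra which is NOT finite-dimensional over the field `k` and `M` is an `R`-module finite-dimensional over `k`, then every
`m ∈ M` is killed by some `r ≠ 0` — the `k`-linear map `r ↦ r • m : R → M` cannot be injective. [cite: Lang2002, Ch. III §5] -/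
theorem exists_ne_zero_smul_eq_zero_of_finiteDimensional (hR : ¬ Module.Finite k R) [FiniteDimensional k M] (m : M) :
    ∃ r : R, r ≠ 0 ∧ r • m = 0 := by
  by_contra h
  apply hR
  have hinj : Injective ((LinearMap.toSpanSingleton R M m).restrictScalars k) := by
    rw [injective_iff_map_eq_zero]
    intro r hr
    by_contra hr0
    exact h ⟨r, hr0, hr⟩
  exact Module.Finite.of_injective ((LinearMap.toSpanSingleton R M m).restrictScalars k) hinj

/-- **RANK ZERO**: under the same hypotheses `rank_R M = 0` (Mathlib `rank_eq_zero_iff`). [cite: Bourbaki1989CommAlg, Ch. II §2 no. 4 Thm. 1] [cite: Lang2002, Ch. XVI §3] [cite: Lang2002, Ch. III §5] -/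
theorem rank_eq_zero_of_finiteDimensional (hR : ¬ Module.Finite k R) [FiniteDimensional k M] : Module.rank R M = 0 :=
  rank_eq_zero_iff.2 (exists_ne_zero_smul_eq_zero_of_finiteDimensional hR)

/-- **`k[τ^±]` IS NOT FINITE-DIMENSIONAL over `k`**: the monomials `T^n`, `n ∈ ℤ`, form a `k`-basis (Mathlib `AddMonoidAlgebra.basis` of `LaurentPolynomial k = k[ℤ]`), and `ℤ` is
infinite. [cite: Lang2002, Ch. II §3] -/
theorem not_module_finite_laurentPolynomial : ¬ Module.Finite k (LaurentPolynomial k) := by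
  intro h
  have : _root_.Finite ℤ := Module.Finite.finite_basis (AddMonoidAlgebra.basis ℤ k : Module.Basis ℤ k (LaurentPolynomial k))
  exact not_finite ℤ

/-- **A FINITE-DIMENSIONAL `k[τ^±]`-MODULE HAS RANK ZERO.** [cite: Bourbaki1989CommAlg, Ch. II §2 no. 4 Thm. 1] [cite: Lang2002, Ch. XVI §3] [cite: Lang2002, Ch. III §5] -/
theorem rank_laurentPolynomial_eq_zero_of_finiteDimensional {V : Type*} [AddCommGroup V] [Module (LaurentPolynomial k) V] [Module k V]
    [IsScalarTower k (LaurentPolynomial k) V] [FiniteDimensional k V] : Module.rank (LaurentPolynomial k) V = 0 :=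
  rank_eq_zero_of_finiteDimensional not_module_finite_laurentPolynomial

end RankZero

/-! ## §3 The consumer's form: a two-step free resolution of a finite-dimensional module has equal ranks -/

section Resolution

universe u v w

variable {k : Type w} [Field k] {R : Type u} [CommRing R] [IsDomain R] [Algebra k R]
  {C₁ C₀ V : Type v} [AddCommGroup C₁] [Module R C₁] [AddCommGroup C₀] [Module R C₀]
  [AddCommGroup V] [Module R V] [Module k V] [IsScalarTower k R V]

/-- **`rank_R C₀ = rank_R C₁`** for `0 → C₁ → C₀ → V → 0` exact over a commutative domain `R` which is a `k`-algebra not finite-dimensional over `k`, with `V` finite-dimensional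
over `k` (§1 + §2). [cite: Bourbaki1989CommAlg, Ch. II §2 no. 4 Thm. 1] [cite: Lang2002, Ch. XVI §3] -/
theorem rank_eq_rank_of_exact_of_finiteDimensional (hR : ¬ Module.Finite k R) [FiniteDimensional k V]
    (ι : C₁ →ₗ[R] C₀) (p : C₀ →ₗ[R] V) (hι : Injective ι) (hexact : Exact ι p) (hp : Surjective p) :
    Module.rank R C₀ = Module.rank R C₁ :=
  rank_eq_rank_of_exact_of_rank_eq_zero ι p hι hexact hp (rank_eq_zero_of_finiteDimensional hR)

/-- The `finrank` form for `C₀` of finite rank. [cite: Bourbaki1989CommAlg, Ch. II §2 no. 4 Thm. 1] [cite: Lang2002, Ch. XVI §3] -/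
theorem finrank_eq_finrank_of_exact_of_finiteDimensional (hR : ¬ Module.Finite k R) [FiniteDimensional k V]
    (ι : C₁ →ₗ[R] C₀) (p : C₀ →ₗ[R] V) (hι : Injective ι) (hexact : Exact ι p) (hp : Surjective p) [Module.Finite R C₀] :
    Module.finrank R C₀ = Module.finrank R C₁ := by
  have h := rank_eq_rank_of_exact_of_finiteDimensional hR ι p hι hexact hp
  exact congrArg Cardinal.toNat h

/-- **FREE RESOLUTIONS: `dim_k W₀ = dim_k W₁`.**  If `C_q ≃ R ⊗_k W_q` (`R`-linearly) with `W_q` finite-dimensional over `k`, and `0 → C₁ → C₀ → V → 0` is exact with `V` finite-dimensional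
over `k` (`R` a commutative domain, a `k`-algebra not finite-dimensional over `k`), then `dim_k W₀ = dim_k W₁` (Mathlib `Module.finrank_baseChange`).
[cite: Bourbaki1989CommAlg, Ch. II §2 no. 4 Thm. 1] [cite: Lang2002, Ch. XVI §3] [cite: Lang2002, Ch. XVI §4] -/
theorem finrank_eq_finrank_of_free_resolution (hR : ¬ Module.Finite k R) [FiniteDimensional k V]
    {W₁ W₀ : Type v} [AddCommGroup W₁] [Module k W₁] [FiniteDimensional k W₁] [AddCommGroup W₀] [Module k W₀] [FiniteDimensional k W₀]
    (e₁ : C₁ ≃ₗ[R] TensorProduct k R W₁) (e₀ : C₀ ≃ₗ[R] TensorProduct k R W₀)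
    (ι : C₁ →ₗ[R] C₀) (p : C₀ →ₗ[R] V) (hι : Injective ι) (hexact : Exact ι p) (hp : Surjective p) :
    Module.finrank k W₀ = Module.finrank k W₁ := by
  haveI : Module.Finite R C₀ := Module.Finite.equiv e₀.symm
  have h := finrank_eq_finrank_of_exact_of_finiteDimensional hR ι p hι hexact hp
  rwa [e₀.finrank_eq, e₁.finrank_eq, Module.finrank_baseChange, Module.finrank_baseChange] at h

end Resolution

end Literature.LinearAlgebra.RankEulerCharacteristic
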